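import Summits.FinalStateConjecture.FinalStateConjecture.Theorems.PhotonSphereChannelsKerrDevDefs
import Summits.FinalStateConjecture.FinalStateConjecture.Theorems.PhotonSphereChannelsChannelsResolveTameDevelopmentsRKerrDevBasics
import HarnessLib

/-!
# Route PhotonSphereChannels · crux `ChannelsResolveTameDevelopmentsR` (K2R, stmt-FinalStateConjecture-14075) — the global
# closeness predicates of stub S3 `stub_windowToGlobalBridge` (line `kerr-isolation-dichotomy`, lead c2; stub-worker S3)

Stub S3 of the skeleton `Cruxes/ChannelsResolveTameDevelopmentsR/Lines/kerr_isolation_dichotomy.lean` (the WINDOW-TO-GLOBAL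
BRIDGE) concludes, for a silent hull element `(𝓢, E, p)`, that the end `E` is GLOBALLY `δ`-close to a Kerr of an admissible box
(`EndDatum.IsGloballyClose M a δ`: ONE injective smooth chart of the whole Kerr exterior `{r > r₊}` onto `E.doc` with `C²` sup
deviation `≤ δ`) or globally `δ`-flat (`EndDatum.IsGloballyFlat δ`), and stub S2 consumes exactly these two predicates. This file
proves their elementary, sorry-free structure (vocabulary of `Theorems/PhotonSphereChannelsKerrDevDefs.lean` over
`Theorems/PhotonSphereChannelsTameHullDefs.lean`; nothing posited, no new definition):

* §1 two facts on the `Cᵏ` sup norm `supCkENorm` of `KerrConvergence.lean`: it vanishes iff every derivative of order `≤ k`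
  vanishes on the set (`supCkENorm_eq_zero_iff`), hence a function with vanishing `Cᵏ` sup norm vanishes on the set
  (`eq_zero_of_supCkENorm_eq_zero`, order `0` and `norm_iteratedFDeriv_zero`); and the extension by zero
  `Spacetime.deviationExtend` of an identically vanishing deviation is the zero function (`deviationExtend_eq_zero`);
* §2 monotonicity in `δ` (registered sub-goals `stub_isGloballyClose_mono`, `stub_isGloballyFlat_mono`);
* §3 the level `δ = 0`: `E.IsGloballyClose M a 0 ↔ IsKerrDoc 𝓢 E.doc M a` (registered sub-goal
  `stub_isGloballyClose_zero_iff_isKerrDoc`: same chart; `Ψ^* g − g_{M,a} = 0` on the exterior iff its extension by zero has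
  vanishing `C²` sup norm over the open exterior — the junk value of `deviationExtend` off the domain is `0` and is never met
  because the sup is over the exterior only), whence `IsKerrDoc ⇒ IsGloballyClose M a δ` for every `δ`; and, for an end whose
  d.o.c. is the whole spacetime, `E.IsGloballyFlat 0 ↔ IsMinkowski 𝓢` (registered sub-goal
  `stub_isGloballyFlat_zero_iff_isMinkowski`: bijective = injective + `range = univ`), whence
  `IsMinkowski 𝓢 ⇒ E.doc = univ ⇒ E.IsGloballyFlat δ`;
* §4 the documented degeneracy of S3's window hypothesis at NON-POSITIVE scales, made explicit: by `kerrDev_of_nonpos`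
  (`…RKerrDevBasics`) the hypothesis `∀ᶠ n, kerrDev 𝒟 (q n) R₀ ≤ η` is vacuously true for `R₀ ≤ 0`
  (`stub_windowHypothesis_of_nonpos`), so the bridge clause of S3 at a scale `R₀ ≤ 0` is the UNCONDITIONAL statement "every
  silent hull element of the class is globally `δ`-close to a box Kerr or globally `δ`-flat"
  (`stub_bridge_of_nonposScale`, `bridge_of_unconditional`). S3 says `∃ R₀`, so a proof may (and must, to use the hypothesis) pick `R₀ > 0`;
  nothing in the statement forces it, and this is harmless for the truth value of S3 (an existential over a vacuous instance
  only adds a disjunct that is itself the strongest instance). The audit of the `R₀ > 0` instances (far re-basing of hull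
  elements makes the window hypothesis inert at EVERY fixed scale) is recorded in the lead's evidence file
  `stub_windowToGlobalBridge_missing.lean`, not here.

References: the predicates paraphrase "converges to a nearby Kerr solution" of Dafermos–Luk, arXiv:1710.01722, Conjecture 1
[DafermosLuk2017] and Christodoulou–Klainerman 1993, Thm. 1.0.2 [ChristodoulouKlainerman1993]; the sup norms are Bartnik's
(CPAM 39 (1986), (1.3)) [Bartnik1986] as vendored from DHRT arXiv:2104.08222, §1 [arXiv210408222].
-/

noncomputable section

-- the operator-norm instance on `E4 →L[ℝ] E4 →L[ℝ] ℝ` needs one more level of pending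
-- instance problems than the default (as in `PhotonSphereChannelsKerrDevDefs.lean`)
set_option maxSynthPendingDepth 3
-- every `Summit.FinalStateConjecture.FinalStateConjecture.…` name repeats the summit = sub-problem segment (D-0017 layout)
set_option linter.dupNamespace false

open Set Filter Function TopologicalSpace Manifold Bundle
open scoped Topology Manifold ContDiff ENNReal NNReal

namespace Summit.FinalStateConjecture.FinalStateConjecture.Theorems

open Literature.Geometry.Lorentzian
open Summit.FinalStateConjecture.FinalStateConjecture.Theorems.TameHull

/-! ### §1 Vanishing of `Cᵏ` sup norms and of extended deviations -/

section SupNorm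

variable {F G : Type*} [NormedAddCommGroup F] [NormedSpace ℝ F] [NormedAddCommGroup G] [NormedSpace ℝ G]

/-- The `Cᵏ` sup norm over `S` vanishes iff every derivative of order `≤ k` vanishes on `S` (Bartnik 1986, (1.3): a
supremum of extended norms). [cite: Bartnik1986, (1.3)] -/
theorem supCkENorm_eq_zero_iff (S : Set F) (k : ℕ) (f : F → G) :
    supCkENorm S k f = 0 ↔ ∀ m ≤ k, ∀ x ∈ S, iteratedFDeriv ℝ m f x = 0 := by
  simp only [supCkENorm, ENNReal.iSup_eq_zero, enorm_eq_zero]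

/-- A function whose `Cᵏ` sup norm over `S` vanishes vanishes on `S` (order `0`: `‖D⁰ f (x)‖ = ‖f x‖`).
[cite: Bartnik1986, (1.3)] -/
theorem eq_zero_of_supCkENorm_eq_zero {S : Set F} {k : ℕ} {f : F → G} (h : supCkENorm S k f = 0) {x : F}
    (hx : x ∈ S) : f x = 0 := by
  have h0 : iteratedFDeriv ℝ 0 f x = 0 := (supCkENorm_eq_zero_iff S k f).1 h 0 (Nat.zero_le k) x hx
  have h1 : ‖f x‖ = 0 := by rw [← norm_iteratedFDeriv_zero (𝕜 := ℝ), h0, norm_zero]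
  exact norm_eq_zero.1 h1

end SupNorm

/-- The extension by zero of an identically vanishing deviation `Ψ^* g − g₀ = 0` is the zero function on `E4` (on the
domain it is the deviation, off the domain it is the junk value `0`). [cite: arXiv210408222, §1] -/
theorem deviationExtend_eq_zero {𝓢 : Spacetime.{0} 4} {B : ModelBackground} {Ψ : B.domain → 𝓢.carrier}
    (h : ∀ x, 𝓢.deviation B Ψ x = 0) : 𝓢.deviationExtend B Ψ = 0 := by
  funext y
  by_cases hy : y ∈ B.domain
  · rw [show y = ((⟨y, hy⟩ : B.domain) : E4) from rfl, Spacetime.deviationExtend_coe, h]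
    rfl
  · exact 𝓢.deviationExtend_of_not_mem B Ψ hy

/-! ### §2 Monotonicity in `δ` (registered sub-goals of S3) -/

/-- **Registered sub-goal `stub_isGloballyClose_mono` of S3.** Global `δ`-closeness to Kerr `(M, a)` is monotone in `δ`
(same chart). [cite: DafermosLuk2017, Conjecture 1] -/
theorem stub_isGloballyClose_mono :
    ∀ {𝓢 : Spacetime.{0} 4} (E : EndDatum 𝓢) {M a : ℝ} {δ δ' : ℝ≥0∞},
      E.IsGloballyClose M a δ → δ ≤ δ' → E.IsGloballyClose M a δ' := by
  intro 𝓢 E M a δ δ' h hδ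
  obtain ⟨Ψ, hinj, hsmooth, hrange, hdev, hfut⟩ := h
  exact ⟨Ψ, hinj, hsmooth, hrange, hdev.trans hδ, hfut⟩

/-- **Registered sub-goal `stub_isGloballyFlat_mono` of S3.** Global `δ`-flatness is monotone in `δ` (same chart).
[cite: ChristodoulouKlainerman1993, Thm. 1.0.2] -/
theorem stub_isGloballyFlat_mono :
    ∀ {𝓢 : Spacetime.{0} 4} (E : EndDatum 𝓢) {δ δ' : ℝ≥0∞}, E.IsGloballyFlat δ → δ ≤ δ' → E.IsGloballyFlat δ' := by
  intro 𝓢 E δ δ' h hδ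
  obtain ⟨Ψ, hinj, hsmooth, hrange, hdev, hfut⟩ := h
  exact ⟨Ψ, hinj, hsmooth, hrange, hdev.trans hδ, hfut⟩

/-! ### §3 The level `δ = 0`: exact Kerr d.o.c. and Minkowski space -/

/-- **Registered sub-goal `stub_isGloballyClose_zero_iff_isKerrDoc` of S3.** Global `0`-closeness of the end to Kerr
`(M, a)` IS the statement that its domain of outer communications is an exact Kerr `(M, a)` exterior (`IsKerrDoc`): the two
predicates have the same chart clauses, and `Ψ^* g − g_{M,a} = 0` at every exterior point iff the extension by zero of the
deviation has vanishing `C²` sup norm over the (open) exterior — forward by `deviationExtend_eq_zero` and `supCkENorm_zero`,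
backward by `eq_zero_of_supCkENorm_eq_zero` at exterior points, where the extension agrees with the deviation.
[cite: DafermosLuk2017, Conjecture 1] -/
theorem stub_isGloballyClose_zero_iff_isKerrDoc :
    ∀ {𝓢 : Spacetime.{0} 4} (E : EndDatum 𝓢) (M a : ℝ), E.IsGloballyClose M a 0 ↔ IsKerrDoc 𝓢 E.doc M a := by
  intro 𝓢 E M a
  constructor
  · rintro ⟨Ψ, hinj, hsmooth, hrange, hdev, hfut⟩
    refine ⟨Ψ, hinj, hsmooth, hrange, fun x ↦ ?_, hfut⟩
    have h0 : supCkENorm (Kerr.exterior M a : Set E4) 2 (𝓢.deviationExtend (Kerr.background M a) Ψ) = 0 :=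
      nonpos_iff_eq_zero.1 hdev
    have hx : 𝓢.deviationExtend (Kerr.background M a) Ψ x.1 = 0 := eq_zero_of_supCkENorm_eq_zero h0 x.2
    rwa [Spacetime.deviationExtend_coe] at hx
  · rintro ⟨Ψ, hinj, hsmooth, hrange, hdev, hfut⟩
    refine ⟨Ψ, hinj, hsmooth, hrange, le_of_eq ?_, hfut⟩
    rw [deviationExtend_eq_zero hdev, supCkENorm_zero]

/-- An exact Kerr `(M, a)` d.o.c. is globally `δ`-close to Kerr `(M, a)` for every `δ` (the form in which S2's exact
alternative feeds back into S3's conclusion). [cite: DafermosLuk2017, Conjecture 1] -/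
theorem isGloballyClose_of_isKerrDoc {𝓢 : Spacetime.{0} 4} (E : EndDatum 𝓢) {M a : ℝ} (h : IsKerrDoc 𝓢 E.doc M a)
    (δ : ℝ≥0∞) : E.IsGloballyClose M a δ :=
  stub_isGloballyClose_mono E ((stub_isGloballyClose_zero_iff_isKerrDoc E M a).2 h) zero_le

/-- **Registered sub-goal `stub_isGloballyFlat_zero_iff_isMinkowski` of S3.** For an end whose domain of outer
communications is the whole spacetime (the case of an eternal far cylinder in Minkowski space: `I⁺(far) ∩ I⁻(far) = 𝓢`),
global `0`-flatness of the end IS the statement that `𝓢` is Minkowski space (`IsMinkowski`): bijective = injective with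
`range = univ`, and `Ψ^* g − η = 0` everywhere iff its `C²` sup norm over `univ` vanishes.
[cite: ChristodoulouKlainerman1993, Thm. 1.0.2] -/
theorem stub_isGloballyFlat_zero_iff_isMinkowski :
    ∀ {𝓢 : Spacetime.{0} 4} (E : EndDatum 𝓢), E.doc = Set.univ → (E.IsGloballyFlat 0 ↔ IsMinkowski 𝓢) := by
  intro 𝓢 E hdoc
  constructor
  · rintro ⟨Ψ, hinj, hsmooth, hrange, hdev, hfut⟩
    have h0 : supCkENorm (Set.univ : Set E4) 2 (𝓢.minkowskiDeviation Ψ) = 0 := nonpos_iff_eq_zero.1 hdev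
    refine ⟨Ψ, ⟨hinj, Set.range_eq_univ.1 (hrange.trans hdoc)⟩, hsmooth,
      fun x ↦ eq_zero_of_supCkENorm_eq_zero h0 (Set.mem_univ x), hfut⟩
  · rintro ⟨Ψ, hbij, hsmooth, hdev, hfut⟩
    have h0 : 𝓢.minkowskiDeviation Ψ = 0 := funext hdev
    refine ⟨Ψ, hbij.1, hsmooth, (Set.range_eq_univ.2 hbij.2).trans hdoc.symm, le_of_eq ?_, hfut⟩
    rw [h0, supCkENorm_zero]

/-- Minkowski space, seen from an end whose d.o.c. is everything, is globally `δ`-flat for every `δ`.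
[cite: ChristodoulouKlainerman1993, Thm. 1.0.2] -/
theorem isGloballyFlat_of_isMinkowski {𝓢 : Spacetime.{0} 4} (E : EndDatum 𝓢) (h : IsMinkowski 𝓢)
    (hdoc : E.doc = Set.univ) (δ : ℝ≥0∞) : E.IsGloballyFlat δ :=
  stub_isGloballyFlat_mono E ((stub_isGloballyFlat_zero_iff_isMinkowski E hdoc).2 h) zero_le

/-! ### §4 The degenerate scales `R₀ ≤ 0` of the bridge's window hypothesis -/

/-- **Registered sub-goal `stub_windowHypothesis_of_nonpos` of S3.** At a non-positive scale the window hypothesis of the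
bridge, `∀ᶠ n, kerrDev 𝒟 (q n) R₀ ≤ η`, holds for EVERY sequence and every level: `kerrDev · R₀ = 0` for `R₀ ≤ 0`
(`kerrDev_of_nonpos`, the empty window). [folklore] -/
theorem stub_windowHypothesis_of_nonpos :
    ∀ {𝓢 : Spacetime.{0} 4} (q : ℕ → 𝓢.carrier) (η : ℝ≥0∞) {R₀ : ℝ}, R₀ ≤ 0 →
      ∀ᶠ n in atTop, kerrDev 𝓢 (q n) R₀ ≤ η :=
  fun q _ _ hR ↦ Eventually.of_forall fun n ↦ (kerrDev_of_nonpos (q n) hR).trans_le zero_le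

section Bridge

variable {X : Type} [TopologicalSpace X] [ChartedSpace E3 X] [IsManifold (𝓡 3) ∞ X]
  [T2Space X] [SecondCountableTopology X] [ConnectedSpace X] {D : InitialDataSet (𝓡 3) X}

/-- **Registered sub-goal `stub_bridge_of_nonposScale` of S3 — the degeneracy `R₀ ≤ 0` made explicit.** If the bridge
clause of `stub_windowToGlobalBridge` (its matrix after the prefix `∃ m₀ M₁ θ … ∀ δ … ∃ η … ∃ R₀`, verbatim) holds at some
NON-POSITIVE scale `R₀` (any level `η`), then it holds UNCONDITIONALLY: every silent `(Λ, r₀)`-hull element of `𝒟` is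
globally `δ`-close to a Kerr of the box or globally `δ`-flat — the window hypothesis is vacuously true there
(`stub_windowHypothesis_of_nonpos`) and a hull element's base sequence is future-escaping by definition. Consequence for the
registered S3 (`… ∃ R₀, …`): its instances `R₀ ≤ 0` assert unconditional closeness of ALL silent hull elements, so a proof
that actually uses the window hypothesis must exhibit `R₀ > 0`; the `∃ R₀` permits this and nothing in the statement forces
it — harmless for the truth value, since the degenerate instance is the strongest one (`bridge_of_unconditional`). No
development hypothesis is needed. [folklore] -/
theorem stub_bridge_of_nonposScale :
    ∀ {X : Type} [TopologicalSpace X] [ChartedSpace E3 X] [IsManifold (𝓡 3) ∞ X] [T2Space X]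
      [SecondCountableTopology X] [ConnectedSpace X] {D : InitialDataSet (𝓡 3) X}
      (𝒟 : VacuumCauchyDevelopment D) [𝒟.metric.HasLeviCivita] (Λ : ℝ≥0) (r₀ m₀ M₁ θ : ℝ) (δ η : ℝ≥0∞) (R₀ : ℝ),
      R₀ ≤ 0 →
        (∀ q : ℕ → 𝒟.carrier, IsFutureEscaping 𝒟 q →
          (∀ᶠ n in atTop, kerrDev 𝒟.toSpacetime (q n) R₀ ≤ η) →
            ∀ (𝓢 : Spacetime.{0} 4) (E : EndDatum 𝓢) (p : 𝓢.carrier),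
              IsHullElement 𝒟 Λ r₀ q 𝓢 E p → E.IsSilent →
                (∃ M a : ℝ, m₀ ≤ M ∧ M ≤ M₁ ∧ |a| ≤ (1 - θ) * M ∧ E.IsGloballyClose M a δ) ∨
                  E.IsGloballyFlat δ) →
        ∀ (q : ℕ → 𝒟.carrier) (𝓢 : Spacetime.{0} 4) (E : EndDatum 𝓢) (p : 𝓢.carrier),
          IsHullElement 𝒟 Λ r₀ q 𝓢 E p → E.IsSilent →
            (∃ M a : ℝ, m₀ ≤ M ∧ M ≤ M₁ ∧ |a| ≤ (1 - θ) * M ∧ E.IsGloballyClose M a δ) ∨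
              E.IsGloballyFlat δ := by
  intro X _ _ _ _ _ _ D 𝒟 _ Λ r₀ m₀ M₁ θ δ η R₀ hR h q 𝓢 E p hhull hsil
  exact h q hhull.isFutureEscaping (stub_windowHypothesis_of_nonpos q η hR) 𝓢 E p hhull hsil

omit [T2Space X] [SecondCountableTopology X] in
/-- Conversely (and trivially) the unconditional statement gives the bridge clause at EVERY scale and level: discard the
window hypothesis. Together with `stub_bridge_of_nonposScale`: at scales `R₀ ≤ 0` the bridge clause and the unconditional
statement are equivalent. [folklore] -/
theorem bridge_of_unconditional (𝒟 : VacuumCauchyDevelopment D) [𝒟.metric.HasLeviCivita] {Λ : ℝ≥0}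
    {r₀ m₀ M₁ θ : ℝ} {δ : ℝ≥0∞}
    (h : ∀ (q : ℕ → 𝒟.carrier) (𝓢 : Spacetime.{0} 4) (E : EndDatum 𝓢) (p : 𝓢.carrier),
      IsHullElement 𝒟 Λ r₀ q 𝓢 E p → E.IsSilent →
        (∃ M a : ℝ, m₀ ≤ M ∧ M ≤ M₁ ∧ |a| ≤ (1 - θ) * M ∧ E.IsGloballyClose M a δ) ∨ E.IsGloballyFlat δ)
    (η : ℝ≥0∞) (R₀ : ℝ) :
    ∀ q : ℕ → 𝒟.carrier, IsFutureEscaping 𝒟 q → (∀ᶠ n in atTop, kerrDev 𝒟.toSpacetime (q n) R₀ ≤ η) →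
      ∀ (𝓢 : Spacetime.{0} 4) (E : EndDatum 𝓢) (p : 𝓢.carrier), IsHullElement 𝒟 Λ r₀ q 𝓢 E p → E.IsSilent →
        (∃ M a : ℝ, m₀ ≤ M ∧ M ≤ M₁ ∧ |a| ≤ (1 - θ) * M ∧ E.IsGloballyClose M a δ) ∨ E.IsGloballyFlat δ :=
  fun q _ _ 𝓢 E p hhull hsil ↦ h q 𝓢 E p hhull hsil

omit [T2Space X] [SecondCountableTopology X] in
/-- **Unconditional closeness implies S3 for the development and the class** (any box with `0 < m₀`, `0 < θ`; `η = 1`,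
`R₀ = 0`): the shape in which dark rigidity plus the parameter census yield the registered S3 with the window hypothesis
discarded (lead's evidence file). The conclusion is verbatim the part of `stub_windowToGlobalBridge` after `∀ (Λ) (r₀)`.
[folklore] -/
theorem windowToGlobalBridge_of_unconditional (𝒟 : VacuumCauchyDevelopment D) [𝒟.metric.HasLeviCivita] (Λ : ℝ≥0)
    (r₀ : ℝ) {m₀ M₁ θ : ℝ} (hm₀ : 0 < m₀) (hθ : 0 < θ)
    (h : ∀ δ : ℝ≥0∞, 0 < δ → ∀ (q : ℕ → 𝒟.carrier) (𝓢 : Spacetime.{0} 4) (E : EndDatum 𝓢) (p : 𝓢.carrier),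
      IsHullElement 𝒟 Λ r₀ q 𝓢 E p → E.IsSilent →
        (∃ M a : ℝ, m₀ ≤ M ∧ M ≤ M₁ ∧ |a| ≤ (1 - θ) * M ∧ E.IsGloballyClose M a δ) ∨ E.IsGloballyFlat δ) :
    ∃ (m₀ M₁ θ : ℝ), 0 < m₀ ∧ 0 < θ ∧ ∀ δ : ℝ≥0∞, 0 < δ →
      ∃ η : ℝ≥0∞, 0 < η ∧ ∃ R₀ : ℝ, ∀ q : ℕ → 𝒟.carrier, IsFutureEscaping 𝒟 q →
        (∀ᶠ n in atTop, kerrDev 𝒟.toSpacetime (q n) R₀ ≤ η) →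
          ∀ (𝓢 : Spacetime.{0} 4) (E : EndDatum 𝓢) (p : 𝓢.carrier),
            IsHullElement 𝒟 Λ r₀ q 𝓢 E p → E.IsSilent →
              (∃ M a : ℝ, m₀ ≤ M ∧ M ≤ M₁ ∧ |a| ≤ (1 - θ) * M ∧ E.IsGloballyClose M a δ) ∨
                E.IsGloballyFlat δ :=
  ⟨m₀, M₁, θ, hm₀, hθ, fun δ hδ ↦ ⟨1, one_pos, 0, bridge_of_unconditional 𝒟 (h δ hδ) 1 0⟩⟩

end Bridge

end Summit.FinalStateConjecture.FinalStateConjecture.Theorems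

end
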